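import Summits.BirchSwinnertonDyer.BirchSwinnertonDyer.Theorems.CongruentShaFreeCutKatoDescentDatumOfH2
import Literature.NumberTheory.EllipticCurves.Kato2004.IwasawaH2DescentRankOne
import Literature.NumberTheory.EllipticCurves.BSDAnalyticRank
import HarnessLib

set_option linter.dupNamespace false
set_option autoImplicit false

/-! # Line `kato-zeta-perrin-riou` v1 of crux B `AnalyticRankOneOfRankOneFiniteShaTwo` (stmt-BirchSwinnertonDyer-19080):
# the registered PRINT stub `stub_reading31` CLOSED MODULO ONE NAMED FACT (Kato (14.9.3)/(14.14.2), bsd-cn100-ty's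
# `Kato2004.finite_descentCokernel_of_rankOne`), by transport along the v2 pin

Cell `bsd-cn100`, prover seat `bsd-cn100-s2-c3` (g7). Helper for stmt-BirchSwinnertonDyer-19080 (line of record
`kato-zeta-perrin-riou` v1, registered 2026-08-26T20:04:57Z; the plan's v1b re-cut folds the named fact into
`stub_refereedInputs` and proves `stub_reading31` in-skeleton by THIS theorem). THEOREMS ONLY; no Theses import
(build rule (H): this file concludes no route decl). HONEST FRAMING: CONDITIONAL on the displayed named fact
`finite_descentCokernel_of_rankOne` [Kato, Astérisque 295, (14.9.3) p. 240 with (14.14.1)–(14.14.2) p. 243;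
Burungale–Skinner App. A §10.1.3 as the printed CM/supersingular instance]; nothing about Kato's main conjecture,
crux B, the congruent number problem or BSD is proved. PARTITION: none — RANK axis.

## What is proved

`reading31_of_fact (h : finite_descentCokernel_of_rankOne)` : the registered signature of `stub_reading31`
VERBATIM — for square-free `n` and every v2-pinned Kato descent datum `D` of `(E_n, 2)`,
`rank E_n(ℚ) = 1 ∧ #Ш(E_n)[2^∞] < ∞ ⟹ D.H2/T·D.H2` finite. Proof: bsd-cn100-ty's
`IwasawaH2Data.finite_coinvariants_H2_of_rankOne` (p464597: the fact + (14.14.1) on the pin + the `lengthAt`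
calculus give `𝐇²_Γ/T` finite on the package `pin.J`) transported along `pin.eH2 : D.H2 ≃ₗ[Λ] J.H2`
(`IwasawaAlgebra.coinvariantsEquiv`). General form `finite_coinvariants_of_pin_of_fact` for any `W`, `p`.

References: K. Kato, Astérisque 295 (2004), (14.9.3) (p. 240), §14.14 (14.14.1)–(14.14.2) (p. 243) [Kato2004Asterisque];
A. Burungale, C. Skinner, App. A to arXiv:2210.10730, §10.1.3 (p. 34) [AlpogeBhargavaShnidman2022]; tree:
`Kato2004/IwasawaH2DescentRankOne.lean` (bsd-cn100-ty), `Theorems/CongruentShaFreeCutKatoDescentDatumOfH2.lean`,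
`IwasawaEulerCharProofs.lean` (`coinvariantsEquiv`).
-/

noncomputable section

open scoped Classical

namespace Summit.BirchSwinnertonDyer.BirchSwinnertonDyer.Theorems.CongruentShaFreeCutKatoReading31

open WeierstrassCurve Field Literature.NumberTheory.EllipticCurves
  Literature.NumberTheory.EllipticCurves.Kato2004 Literature.NumberTheory.EllipticCurves.IwasawaAlgebra
  Literature.NumberTheory.EllipticCurves.Kato2004.EulerSystemValues
  Literature.NumberTheory.GaloisRepresentations
open Summit.BirchSwinnertonDyer.Rank1Residual.Additive (KatoDescentDatum)
open Summit.BirchSwinnertonDyer.BirchSwinnertonDyer.Theorems.CongruentShaFreeCutKatoDescentDatumOfH2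

/-- **(3.1′) on a v2 pin, any `W`, any `p`, modulo the named fact**: for an elliptic `W/ℚ` with a v2 pin
`pin : KatoDescentDatumPinH2 W p D`, `rank W(ℚ) = 1 ∧ #Ш(W)[p^∞] < ∞ ⟹ D.H2/T·D.H2` finite — bsd-cn100-ty's
`IwasawaH2Data.finite_coinvariants_H2_of_rankOne` on `pin.J`, transported along `pin.eH2`.
[cite: Kato2004Asterisque, (14.9.3) (p. 240) and §14.14 (14.14.1)–(14.14.2) (p. 243)]
[cite: AlpogeBhargavaShnidman2022, App. A §10.1.3 (p. 34)] -/
theorem finite_coinvariants_of_pin_of_fact (h : finite_descentCokernel_of_rankOne)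
    {W : WeierstrassCurve ℚ} [W.IsElliptic] {p : ℕ} [Fact p.Prime] [ContinuousSMul ℤ_[p] (W.tateModule p)]
    {D : KatoDescentDatum p} (pin : KatoDescentDatumPinH2 W p D) (hrank : W.mordellWeilRank = 1)
    (hsha : Finite (AddCommGroup.primaryComponent W.sha p)) :
    Finite (IwasawaAlgebra.coinvariants p D.H2) := by
  haveI : Finite (IwasawaAlgebra.coinvariants p pin.J.H2) :=
    IwasawaH2Data.finite_coinvariants_H2_of_rankOne h pin.isCyclotomic pin.isTopGenerator pin.J hrank hsha
  exact Finite.of_equiv _ (IwasawaAlgebra.coinvariantsEquiv pin.eH2).toEquiv.symm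

/-- **The registered stub `stub_reading31` of line `kato-zeta-perrin-riou` v1 (crux B of S2, item 19080), signature
VERBATIM, modulo the ONE named fact `Kato2004.finite_descentCokernel_of_rankOne`**: for square-free `n` and every
v2-pinned Kato descent datum `D` of `(E_n, 2)`, `rank E_n(ℚ) = 1 ∧ #Ш(E_n)[2^∞] < ∞ ⟹ D.H2/T·D.H2` finite.
CONDITIONAL on the displayed fact; the plan's v1b re-cut folds that fact into `stub_refereedInputs` and closes
`stub_reading31` in-skeleton by this theorem. [cite: Kato2004Asterisque, (14.9.3) (p. 240) and §14.14 (14.14.2) (p. 243)]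
[cite: AlpogeBhargavaShnidman2022, App. A §10.1.3 (p. 34)] -/
theorem reading31_of_fact (h : finite_descentCokernel_of_rankOne) :
    ∀ ⦃n : ℕ⦄, Squarefree n →
      ∀ [(congruentNumberCurve n).IsElliptic] [(congruentNumberCurve n).IsGloballyMinimal]
        [ContinuousSMul ℤ_[2] ((congruentNumberCurve n).tateModule 2)]
        (D : KatoDescentDatum 2), Nonempty (KatoDescentDatumPinH2 (congruentNumberCurve n) 2 D) →
        (congruentNumberCurve n).mordellWeilRank = 1 →
          Finite (AddCommGroup.primaryComponent (congruentNumberCurve n).sha 2) →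
            Finite (IwasawaAlgebra.coinvariants 2 D.H2) := by
  intro n _ _ _ _ D hpin hrank hsha
  obtain ⟨pin⟩ := hpin
  exact finite_coinvariants_of_pin_of_fact h pin hrank hsha

end Summit.BirchSwinnertonDyer.BirchSwinnertonDyer.Theorems.CongruentShaFreeCutKatoReading31

end
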